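/-
Copyright: statement-level skeleton of a published paper (lit-balaban cell, Phase-2 proof seat p26 gen 40). No claims beyond
what the kernel checks below.
-/
import Mathlib
import Literature.MathematicalPhysics.QuantumFieldTheory.Balaban1983to89.B3GraphAmplitudeRules
import Literature.MathematicalPhysics.QuantumFieldTheory.Balaban1983to89.B3Sect3LowestOrderGraphs

/-!
# B3 — T. Bałaban, *(Higgs)₂,₃ quantum fields in a finite volume. III. Renormalization*, CMP **88** (1983) 411–445
[Balaban1983Higgs3] — p. 435 [PDF 25], the pictures **(3.6)₂ (the A′-tadpole at the vertex (1.10)) and (3.6)₃ (the φ′-tadpole at the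
vertex (1.6))**: the general Feynman-rule evaluator of `B3GraphAmplitude` / `B3GraphAmplitudeRules` EVALUATED on p18's graphs `g36b`,
`g36c` of these pictures, in closed form — the joined legs become the propagator at coinciding points (*"each pair is replaced by the
corresponding propagator"*, p. 414), the external legs the scalar product of the external fields at the vertex (FILE 3 of the evaluator:
the consistency of the index form with the printed pictures, computed end to end)

statement-level skeleton of published theorems with citation tags; proofs where landed; nothing here is a claim about
the Yang–Mills mass gap

PDF held: `paper:balaban1983-higgs-2-3-quantum-fields-finite-volume` (journal page = PDF page + 410); p. 435 [PDF 25] read by this seat on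
the ×2 render `run/shared/lean/pub/pub-balaban/b2b-balaban-ref1/pages/1983-cmp88-higgs23-III/1983-cmp88-higgs23-III-p025-x2.png` (2026-08-23),
pp. 413–415 as in FILE 2.

CITATION HEADER (lean-in-tree rule).  lit-balaban TYPED SKELETON (HOME `run/shared/lean/pub/lit-balaban/`), PHASE 2, seat p26 gen 40
(unit `lit-balaban-p26`, the Sect. 3 pictures lineage: `B3Eq37Pictures`, `B3LocalizedExpression420`, `B3GraphAmplitude`,
`B3GraphAmplitudeRules`); free-target protocol G.5-34(d), TAKING #4 (HOME/STATUS.md 2026-08-23); design note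
`HOME/lit-balaban-p26/DESIGN-B3-evaluator.md` item 2 (*"PICTURES: the per-picture dictionaries become instances"*).  ROWS **B3.Eq3.6-3.9**
(p. 435: the lowest-order scalar self-energy graphs (3.6)) and **B3.Def@420** (E(G, ·) with body) of `HOME/lit-balaban-r15/ROWS-B3.md` (fold
owner r15; cells only, heads are the owner's / the lead's call).  CONSUMES BY NAME: p18's graphs `B3Sect3LowestOrderGraphs.g36b/g36c`
(p239034 lineage), this seat's evaluator (`amp`, `SLeg/VLeg/OLeg`, `sPairing/vPairing`, `SLine/VLine`, `ExtSLeg/ExtVLeg`, `spartner_eq_*_iff`,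
`Pairing.isLower_iff/mate_eq/not_isLower_of_none`) and rules (`graphAmp`, `rulesOf`, `rule16`, `rule110`, `pleg110`, `vlegs`, `basisE`,
`inner_basisE`, `extS`, `Model`, `Loc`), the typer's `B3Eq18VertexExpansion.leg110`, `HiggsLattice.*`.

THE PRINTED TEXT (verbatim, p. 435 [PDF 25]).  *"Let us start with self-energy graphs for scalar fields. The graphs of lowest order are
[(3.6): three pictures — two vertices (1.8) joined by a φ′-line and an A′-line; the A′-loop at a vertex (1.10); the φ′-loop at the
vertex (1.6)] (D = −d + 2), (3.6) and the renormalized class G_ren contains the corresponding mass renormalization counterterms also: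
[(3.7)]. The two last terms in (3.7) cancel exactly the two last terms in (3.6), so the expressions containing these terms vanish (Wick
ordering)."*; p. 414 [PDF 4], lines 36–46 (×2 render p004): *"Now we can describe an arbitrary expression in the expansion. It consists
of a number of vertices. The maximal number of vertices depends in a simple way on n̄, but it is unessential here. All the A′-legs are
contracted, i.e. they are divided into pairs and each pair is replaced by the corresponding propagator. Some φ′-legs are replaced by
external scalar fields and the remaining are again divided into pairs and each pair is replaced by a propagator, i.e. by G_k(Ω,B̃),
G_k(Ω₂,B̃), δG_k(Ω,Ω₂,B̃) or the operator (1.16). Of course the whole expression is multiplied by a proper combinatorial factor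
connected with the number of ways given expression can be obtained from Gaussian integrals in (1.5)."*

READING (declared).  Print displays no formula for the two tadpoles of (3.6) (only for (3.8), in (3.9)); the closed forms below are
what OUR evaluator (FILE 1's `amp` at FILE 2's rules, i.e. `graphAmp`) returns on p18's drawings `g36c` (one vertex (1.6), φ′-legs 0, 1
joined, 2, 3 external) and `g36b` (one vertex (1.10)_{2,0}, its two A′-legs joined, both φ′-legs external), for arbitrary model data,
localization weight, line kernels and joint external field — with no external A′-leg and no averaging output in these pictures, the
external vector field and the (1.18) output functional are taken trivial (`fun _ => 1`).  The results are the textbook tadpoles: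
(3.6)₃ ↦ `−λ Σ_{x∈Ω₁} w(x) η^d (Σ_a G(x,x)_{aa}) (φ₂(x)·φ₃(x))` (the trace over the internal space of the scalar line kernel at coinciding
points); (3.6)₂ ↦ `(e²/2) Σ_{b} w(b) η^d g_k(b₋)² G(b,b) [φ₀(b₋)·q²φ₁(b₋)]` — the vertex (1.10)_{2,0} with `(g_kA′_b)²` replaced by
`g_k(b₋)²·G(b,b)`, the diagonal of the vector line kernel.  The cancellation against (3.7)₂,₃ (*"Wick ordering"*) is the statement that the
counterterm vertices carry exactly these values; it is recorded by the pictures `B3Eq37Pictures.pic37b/pic37c = pic36b/pic36c` of this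
lineage and is not re-proved here.

WHAT IS TYPED / PROVED (theorems + the small definitions naming legs; no `Prop` fact, no `sorry`; standard axioms).  §1 (3.6)₃: `v0`, `sl`,
`other_sl0/1`, `sl_cases`, `sl_injective`, `isLower_sl0`, `lower_unique`, `ext_iff`, `instIsEmptyVLeg/OLeg`, `line0`, **`uniqueSLine`**
(the φ′-line is the only line), `mate_sl0`; §2 `assign`, `assign_sl0…3`, `assign_injective`, `assign_ext`, the Kronecker bookkeeping
(private), `e2`, `e3`, `univ_extSLeg`, `extS_const`, `sum_extS_const`, **`graphAmp_g36c`** (closed form for any joint external field) and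
**`graphAmp_g36c_extS`** (product external fields: `… (Σ_a Ks(x,a)(x,a)) · (φ₂(x)·φ₃(x))`); §3 (3.6)₂: `w0`, `sb`, `tb`, `sother_none`,
`sb_cases`, `tb_cases`, `sb_injective`, `tb_injective`, `instIsEmptySLine36b` (no φ′-line), `vother_tb0`, `visLower_tb0`, `vlower_unique`,
`vother_ne_none`, `vline0`, **`uniqueVLine36b`**, `instIsEmptyExtVLeg36b`, `vmate_tb0`, `es`; §4 `basisE_eq`, `opCoeff` (matrix entries
`e_a·Te_{a′}`), **`pleg110_basisE`** (the polarized (1.10) bracket on basis fields = Kronecker deltas × `opCoeff`), `assign2`, `extAt`,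
`sum_opCoeff` (`Σ_{a,a′}(e_a·Te_{a′})u_a v_{a′} = u·Tv`), `univ_extSLeg36b`, `extS_extAt`, **`vlegs_basisV`**, **`graphAmp_g36b`** (closed form),
**`graphAmp_g36b_extS`**, **`graphAmp_g36b_diag`** (`… g_k(b₋)² Kv(b,b) · leg110 φ′ (q²) b` — the typer's bracket).
HONEST SCOPE.  (a) These are evaluations of OUR evaluator on p18's drawings; print gives no formula for (3.6)₂,₃ to compare with — the
value of the file is the end-to-end check that the index form, the polarized rules, the line representation by lower endpoints and
the external-leg bookkeeping compute what the Feynman rules say (trace at coinciding points; diagonal of the vector covariance; the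
(1.10) bracket).  (b) (3.6)₁/(3.8)/(3.9) (two vertices (1.8), a differentiated φ′-line and an A′-line) is NOT evaluated here: its
printed form (3.9) fixes conventions for the vector covariance on bonds and for `∂^η G ∂^{η*}` that the kernel PARAMETERS of the
evaluator do not carry; the identification of (3.9) with r15's `expr39` is in `B3LocalizedExpression420` at the level of the kernel Σ(x,x′).
(c) Kernels, weights, model data arbitrary; nothing is claimed about their values (no propagator property is used).  Unit
`lit-balaban-p26` gen 40 (literature-prover-lit-balaban-p26-g40-0), HOME `run/shared/lean/pub/lit-balaban/`, 2026-08-23.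
-/

open Finset
open scoped BigOperators InnerProductSpace

namespace Literature.MathematicalPhysics.QuantumFieldTheory.Balaban1983to89.B3Eq36TadpoleExpressions

open Literature.MathematicalPhysics.QuantumFieldTheory.Balaban1983to89.B3Prop1 (VertexKind)
open Literature.MathematicalPhysics.QuantumFieldTheory.Balaban1983to89.B3Cor23Concrete (Graph)
open Literature.MathematicalPhysics.QuantumFieldTheory.Balaban1983to89.B3Sect3LowestOrderGraphs (g36b g36c)
open Literature.MathematicalPhysics.QuantumFieldTheory.Balaban1983to89.B3GraphAmplitude
open Literature.MathematicalPhysics.QuantumFieldTheory.Balaban1983to89.B3GraphAmplitudeRules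

noncomputable section

variable {nbar : ℕ}

/-! ## §1 The legs and the line of the picture (3.6)₃ (p18's `g36c`: one vertex (1.6), legs 0–1 joined, legs 2, 3 external) -/

/-- The vertex of (3.6)₃. [cite: Balaban1983Higgs3, (3.6) p.435] -/
def v0 (nbar : ℕ) : Fin (g36c nbar).nV := ⟨0, Nat.one_pos⟩

/-- The four φ′-legs of the (1.6) vertex of (3.6)₃. [cite: Balaban1983Higgs3, (3.6) p.435] -/
def sl (nbar : ℕ) (j : Fin 4) : SLeg (g36c nbar).kind := ⟨v0 nbar, j⟩

/-- leg 0 is joined to leg 1. [cite: Balaban1983Higgs3, (3.6) p.435] -/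
theorem other_sl0 : (sPairing (g36c nbar)).other (sl nbar 0) = some (sl nbar 1) := by
  show spartner (g36c nbar) (sl nbar 0) = some (sl nbar 1)
  exact (spartner_eq_some_iff _ _ _).2 rfl

/-- leg 1 is joined to leg 0. [cite: Balaban1983Higgs3, (3.6) p.435] -/
theorem other_sl1 : (sPairing (g36c nbar)).other (sl nbar 1) = some (sl nbar 0) := by
  show spartner (g36c nbar) (sl nbar 1) = some (sl nbar 0)
  exact (spartner_eq_some_iff _ _ _).2 rfl

/-- every φ′-leg of (3.6)₃ is one of the four legs of its vertex. [cite: Balaban1983Higgs3, (3.6) p.435] -/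
theorem sl_cases : ∀ ℓ : SLeg (g36c nbar).kind, ℓ = sl nbar 0 ∨ ℓ = sl nbar 1 ∨ ℓ = sl nbar 2 ∨ ℓ = sl nbar 3 := by
  show ∀ ℓ : SLeg (g36c 0).kind, ℓ = sl 0 0 ∨ ℓ = sl 0 1 ∨ ℓ = sl 0 2 ∨ ℓ = sl 0 3
  decide

/-- the four legs are distinct. [cite: Balaban1983Higgs3, (3.6) p.435] -/
theorem sl_injective : Function.Injective (sl nbar) := by
  intro i j h
  simp only [sl, Sigma.mk.inj_iff, heq_eq_eq, true_and] at h
  exact h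

/-- leg 0 is the lower endpoint of the line {0, 1}. [cite: Balaban1983Higgs3, (3.6) p.435] -/
theorem isLower_sl0 : (sPairing (g36c nbar)).isLower sRank (sl nbar 0) = true :=
  ((sPairing (g36c nbar)).isLower_iff sRank _).2 ⟨sl nbar 1, other_sl0, by show Nat.pair 0 0 < Nat.pair 0 1; decide⟩

/-- … and the only lower endpoint. [cite: Balaban1983Higgs3, (3.6) p.435] -/
theorem lower_unique : ∀ ℓ : SLeg (g36c nbar).kind, (sPairing (g36c nbar)).isLower sRank ℓ = true → ℓ = sl nbar 0 := by
  show ∀ ℓ : SLeg (g36c 0).kind, (sPairing (g36c 0)).isLower sRank ℓ = true → ℓ = sl 0 0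
  decide

/-- the external φ′-legs of (3.6)₃ are the legs 2 and 3. [cite: Balaban1983Higgs3, (3.6) p.435] -/
theorem ext_iff : ∀ ℓ : SLeg (g36c nbar).kind,
    ((sPairing (g36c nbar)).other ℓ = none ↔ ℓ = sl nbar 2 ∨ ℓ = sl nbar 3) := by
  show ∀ ℓ : SLeg (g36c 0).kind, ((sPairing (g36c 0)).other ℓ = none ↔ ℓ = sl 0 2 ∨ ℓ = sl 0 3)
  decide

/-- (3.6)₃ has no A′-legs. [cite: Balaban1983Higgs3, (3.6) p.435] -/
instance instIsEmptyVLeg : IsEmpty (VLeg (g36c nbar).kind) := ⟨fun ℓ => Fin.elim0 (ℓ.2 : Fin 0)⟩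

/-- (3.6)₃ has no averaging outputs. [cite: Balaban1983Higgs3, (3.6) p.435] -/
instance instIsEmptyOLeg : IsEmpty (OLeg (g36c nbar).kind) := ⟨fun ℓ => Fin.elim0 (ℓ.2 : Fin 0)⟩

/-- The φ′-line of (3.6)₃ (represented by its lower endpoint, leg 0). [cite: Balaban1983Higgs3, (3.6) p.435] -/
def line0 (nbar : ℕ) : SLine (g36c nbar) := ⟨sl nbar 0, isLower_sl0⟩

/-- it is the only line. [cite: Balaban1983Higgs3, (3.6) p.435] -/
instance uniqueSLine : Unique (SLine (g36c nbar)) where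
  default := line0 nbar
  uniq := fun l => by
    rcases l with ⟨ℓ, hℓ⟩
    have := lower_unique ℓ hℓ
    subst this
    rfl

/-- the mate of leg 0 is leg 1. [cite: Balaban1983Higgs3, (3.6) p.435] -/
theorem mate_sl0 : (sPairing (g36c nbar)).mate (sl nbar 0) = sl nbar 1 := (sPairing (g36c nbar)).mate_eq other_sl0

/-! ## §2 The index assignments that contribute -/

section Eval

variable {P : HiggsLattice.Params} {N k : ℕ}

/-- The index assignment of (3.6)₃ with the joined legs 0, 1 at `(x, a)` and the external legs 2, 3 at `(x, b)`.
[cite: Balaban1983Higgs3, (3.6) p.435] -/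
def assign (x : HiggsLattice.Site P 0) (ab : Fin N × Fin N) : SLeg (g36c nbar).kind → HiggsLattice.Site P 0 × Fin N :=
  fun ℓ => if ℓ = sl nbar 0 ∨ ℓ = sl nbar 1 then (x, ab.1) else (x, ab.2)

/-- `assign` on leg 0: `(x, a)`. [cite: Balaban1983Higgs3, (3.6) p.435] -/
theorem assign_sl0 (x : HiggsLattice.Site P 0) (ab : Fin N × Fin N) : assign (nbar := nbar) x ab (sl nbar 0) = (x, ab.1) := by
  simp [assign]

/-- `assign` on leg 1: `(x, a)`. [cite: Balaban1983Higgs3, (3.6) p.435] -/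
theorem assign_sl1 (x : HiggsLattice.Site P 0) (ab : Fin N × Fin N) : assign (nbar := nbar) x ab (sl nbar 1) = (x, ab.1) := by
  simp [assign]

/-- `assign` on leg 2: `(x, b)`. [cite: Balaban1983Higgs3, (3.6) p.435] -/
theorem assign_sl2 (x : HiggsLattice.Site P 0) (ab : Fin N × Fin N) : assign (nbar := nbar) x ab (sl nbar 2) = (x, ab.2) := by
  have h1 : sl nbar 2 ≠ sl nbar 0 := fun h => by have := sl_injective h; exact absurd this (by decide)
  have h2 : sl nbar 2 ≠ sl nbar 1 := fun h => by have := sl_injective h; exact absurd this (by decide)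
  simp [assign, h1, h2]

/-- `assign` on leg 3: `(x, b)`. [cite: Balaban1983Higgs3, (3.6) p.435] -/
theorem assign_sl3 (x : HiggsLattice.Site P 0) (ab : Fin N × Fin N) : assign (nbar := nbar) x ab (sl nbar 3) = (x, ab.2) := by
  have h1 : sl nbar 3 ≠ sl nbar 0 := fun h => by have := sl_injective h; exact absurd this (by decide)
  have h2 : sl nbar 3 ≠ sl nbar 1 := fun h => by have := sl_injective h; exact absurd this (by decide)
  simp [assign, h1, h2]

/-- `assign x` is injective. [cite: Balaban1983Higgs3, (3.6) p.435] -/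
theorem assign_injective (x : HiggsLattice.Site P 0) : Function.Injective (assign (nbar := nbar) (N := N) x) := by
  rintro ⟨a, b⟩ ⟨a', b'⟩ h
  have h0 := congrFun h (sl nbar 0)
  have h2 := congrFun h (sl nbar 2)
  rw [assign_sl0, assign_sl0] at h0
  rw [assign_sl2, assign_sl2] at h2
  simp only [Prod.mk.injEq, true_and] at h0 h2
  rw [h0, h2]

/-- on `assign x (a, b)` the external legs sit at `(x, b)`. [cite: Balaban1983Higgs3, (3.6) p.435] -/
theorem assign_ext (x : HiggsLattice.Site P 0) (ab : Fin N × Fin N) :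
    (fun ℓ : ExtSLeg (g36c nbar) => assign x ab ℓ.1) = fun _ => (x, ab.2) := by
  funext ℓ
  rcases (ext_iff ℓ.1).1 ℓ.2 with h | h
  · rw [h, assign_sl2]
  · rw [h, assign_sl3]


/-- kernel: the Kronecker-delta sum of (3.6)₃ — over all index assignments of the four legs, the deltas of the two scalar products
of the (1.6) vertex at the site `x` leave the joined pair at a common `(x, a)` and the external pair at a common `(x, b)`. [folklore] -/
private theorem delta_sum (x : HiggsLattice.Site P 0) (K : HiggsLattice.Site P 0 × Fin N → HiggsLattice.Site P 0 × Fin N → ℝ)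
    (Φ : (ExtSLeg (g36c nbar) → HiggsLattice.Site P 0 × Fin N) → ℝ) :
    ∑ α : SLeg (g36c nbar).kind → HiggsLattice.Site P 0 × Fin N,
        (if x = (α (sl nbar 0)).1 ∧ x = (α (sl nbar 1)).1 ∧ (α (sl nbar 0)).2 = (α (sl nbar 1)).2 then (1 : ℝ) else 0) *
          (if x = (α (sl nbar 2)).1 ∧ x = (α (sl nbar 3)).1 ∧ (α (sl nbar 2)).2 = (α (sl nbar 3)).2 then (1 : ℝ) else 0) *
          (Φ (fun ℓ => α ℓ.1) * K (α (sl nbar 0)) (α (sl nbar 1))) =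
      (∑ a : Fin N, K (x, a) (x, a)) * ∑ b : Fin N, Φ (fun _ => (x, b)) := by
  classical
  set S : Finset (SLeg (g36c nbar).kind → HiggsLattice.Site P 0 × Fin N) := univ.image (assign x) with hS
  -- (i) the summand vanishes off the image of `assign x`
  rw [← Finset.sum_subset (Finset.subset_univ S)]
  · rw [hS, Finset.sum_image fun ab _ ab' _ h => assign_injective x h]
    have hterm : ∀ ab : Fin N × Fin N,
        (if x = (assign (nbar := nbar) x ab (sl nbar 0)).1 ∧ x = (assign (nbar := nbar) x ab (sl nbar 1)).1 ∧
              (assign (nbar := nbar) x ab (sl nbar 0)).2 = (assign (nbar := nbar) x ab (sl nbar 1)).2 then (1 : ℝ) else 0) *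
          (if x = (assign (nbar := nbar) x ab (sl nbar 2)).1 ∧ x = (assign (nbar := nbar) x ab (sl nbar 3)).1 ∧
              (assign (nbar := nbar) x ab (sl nbar 2)).2 = (assign (nbar := nbar) x ab (sl nbar 3)).2 then (1 : ℝ) else 0) *
          (Φ (fun ℓ => assign x ab ℓ.1) * K (assign (nbar := nbar) x ab (sl nbar 0)) (assign (nbar := nbar) x ab (sl nbar 1))) =
        K (x, ab.1) (x, ab.1) * Φ (fun _ => (x, ab.2)) := by
      intro ab
      rw [assign_ext, assign_sl0, assign_sl1, assign_sl2, assign_sl3]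
      simp only [and_self, if_true, one_mul]
      ring
    simp only [hterm]
    rw [Fintype.sum_prod_type, Finset.sum_mul_sum]
  · intro α _ hα
    by_cases h01 : x = (α (sl nbar 0)).1 ∧ x = (α (sl nbar 1)).1 ∧ (α (sl nbar 0)).2 = (α (sl nbar 1)).2
    · by_cases h23 : x = (α (sl nbar 2)).1 ∧ x = (α (sl nbar 3)).1 ∧ (α (sl nbar 2)).2 = (α (sl nbar 3)).2
      · exfalso
        apply hα
        rw [hS, Finset.mem_image]
        refine ⟨((α (sl nbar 0)).2, (α (sl nbar 2)).2), Finset.mem_univ _, ?_⟩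
        funext ℓ
        rcases sl_cases ℓ with h | h | h | h <;> subst h
        · rw [assign_sl0]; exact Prod.ext h01.1 rfl
        · rw [assign_sl1]; exact Prod.ext h01.2.1 h01.2.2
        · rw [assign_sl2]; exact Prod.ext h23.1 rfl
        · rw [assign_sl3]; exact Prod.ext h23.2.1 h23.2.2
      · rw [if_neg h23, mul_zero, zero_mul]
    · rw [if_neg h01, zero_mul, zero_mul]


/-- (3.6)₃ has no vector line. [cite: Balaban1983Higgs3, (3.6) p.435] -/
instance instIsEmptyVLine : IsEmpty (VLine (g36c nbar)) := ⟨fun l => IsEmpty.false l.1⟩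

/-- The external leg 2 of (3.6)₃. [cite: Balaban1983Higgs3, (3.6) p.435] -/
def e2 (nbar : ℕ) : ExtSLeg (g36c nbar) := ⟨sl nbar 2, (ext_iff _).2 (Or.inl rfl)⟩

/-- The external leg 3 of (3.6)₃. [cite: Balaban1983Higgs3, (3.6) p.435] -/
def e3 (nbar : ℕ) : ExtSLeg (g36c nbar) := ⟨sl nbar 3, (ext_iff _).2 (Or.inr rfl)⟩

/-- the external legs of (3.6)₃ are exactly `e2`, `e3`. [cite: Balaban1983Higgs3, (3.6) p.435] -/
theorem univ_extSLeg : (univ : Finset (ExtSLeg (g36c nbar))) = {e2 nbar, e3 nbar} := by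
  show (univ : Finset (ExtSLeg (g36c 0))) = {e2 0, e3 0}
  decide

/-- `e2 ≠ e3`. [cite: Balaban1983Higgs3, (3.6) p.435] -/
theorem e2_ne_e3 : e2 nbar ≠ e3 nbar := by
  intro h
  have h' := congrArg Subtype.val h
  exact absurd (sl_injective h') (by decide)

/-- A PRODUCT external field (one field per external leg) of (3.6)₃ at the contributing assignments: both external legs at the site
`x` with the internal index `b`. [cite: Balaban1983Higgs3, p.419] -/
theorem extS_const (φ : ExtSLeg (g36c nbar) → HiggsLattice.ScalarField P 0 N) (x : HiggsLattice.Site P 0) (b : Fin N) :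
    extS (g36c nbar) φ (fun _ => (x, b)) = φ (e2 nbar) x b * φ (e3 nbar) x b := by
  unfold extS
  rw [show (∏ ℓ : ExtSLeg (g36c nbar), φ ℓ x b) = ∏ ℓ ∈ ({e2 nbar, e3 nbar} : Finset _), φ ℓ x b by rw [← univ_extSLeg],
    Finset.prod_pair e2_ne_e3]

/-- kernel: the scalar product of `W = ℝ^N` in coordinates. [folklore] -/
private theorem inner_eq_sum_coord' (u v : HiggsCovariance.E N) : ⟪u, v⟫_ℝ = ∑ a, u a * v a := by
  rw [PiLp.inner_apply]
  simp [mul_comm]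

/-- … summed over the internal index: the scalar product `φ₂(x)·φ₃(x)` of the two external fields at the vertex.
[cite: Balaban1983Higgs3, (3.6) p.435] -/
theorem sum_extS_const (φ : ExtSLeg (g36c nbar) → HiggsLattice.ScalarField P 0 N) (x : HiggsLattice.Site P 0) :
    ∑ b : Fin N, extS (g36c nbar) φ (fun _ => (x, b)) = ⟪φ (e2 nbar) x, φ (e3 nbar) x⟫_ℝ := by
  simp only [extS_const]
  rw [inner_eq_sum_coord']

variable [DecidableEq (HiggsLattice.PBond P 0)]

/-- **The evaluator EVALUATED on the picture (3.6)₃ (the φ′-tadpole at the vertex (1.6))**: for the model data `M`, the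
localization weight `w = (loc v).wS` of its vertex, any scalar line kernel `Ks` (the entries of `G_k(Ω, B̃)` or of one of its (2.6)
pieces) and any joint external scalar field `Φ` (no external vector field, no averaging output: `A`, `Ψ` trivial), the expression of
p18's graph `g36c` is the TADPOLE: `−λ(L^kε) Σ_{x∈Ω₁} w(x) η^d · tr_W G(x, x) · Φ((x,b),(x,b))_{summed over b}` — the joined legs 0, 1 give
the trace of the propagator at coinciding points, the external legs 2, 3 sit at the same site with the same internal index (for a product
field `Φ = extS φ`: `Σ_b φ₂(x)_b φ₃(x)_b = φ₂(x)·φ₃(x)`). [cite: Balaban1983Higgs3, (3.6) p.435] -/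
theorem graphAmp_g36c (M : Model P N k) (dm2 : Fin (g36c nbar).nV → HiggsLattice.Site P 0 → ℝ) (loc : Fin (g36c nbar).nV → Loc P k)
    (Po : OutPairing (g36c nbar)) (Ks : SLine (g36c nbar) → HiggsLattice.Site P 0 × Fin N → HiggsLattice.Site P 0 × Fin N → ℝ)
    (Kv : VLine (g36c nbar) → HiggsLattice.PBond P 0 → HiggsLattice.PBond P 0 → ℝ)
    (Ko : Po.Line oRank → HiggsLattice.Site P k × Fin N → HiggsLattice.Site P k × Fin N → ℝ)
    (Φ : (ExtSLeg (g36c nbar) → HiggsLattice.Site P 0 × Fin N) → ℝ) :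
    graphAmp (g36c nbar) M dm2 loc Po Ks Kv Ko Φ (fun _ => 1) (fun _ => 1) =
      -(M.lamRun * ∑ x ∈ M.Ω₁, (loc (v0 nbar)).wS x * (P.mesh 0 ^ P.d *
        ((∑ a : Fin N, Ks (line0 nbar) (x, a) (x, a)) * ∑ b : Fin N, Φ (fun _ => (x, b))))) := by
  haveI : IsEmpty (Po.Line oRank) := ⟨fun l => IsEmpty.false l.1⟩
  -- the factors of the evaluator on this graph
  have hV : ∀ (α : SLeg (g36c nbar).kind → HiggsLattice.Site P 0 × Fin N) (β : VLeg (g36c nbar).kind → HiggsLattice.PBond P 0)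
      (ο : OLeg (g36c nbar).kind → HiggsLattice.Site P k × Fin N),
      vertexFactor (rulesOf (g36c nbar) M dm2 loc) basisE basisV basisE α β ο =
        rule16 M.lamRun M.Ω₁ (loc (v0 nbar)).wS (fun j => basisE (α (sl nbar j))) := by
    intro α β ο
    unfold vertexFactor
    exact Fin.prod_univ_one _
  have hs : ∀ α : SLeg (g36c nbar).kind → HiggsLattice.Site P 0 × Fin N,
      sLineFactor Ks α = Ks (line0 nbar) (α (sl nbar 0)) (α (sl nbar 1)) := by
    intro α
    unfold sLineFactor
    rw [Fintype.prod_unique]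
    show Ks (line0 nbar) (α (sl nbar 0)) (α ((sPairing (g36c nbar)).mate (sl nbar 0))) = _
    rw [mate_sl0]
  have hv : ∀ β : VLeg (g36c nbar).kind → HiggsLattice.PBond P 0, vLineFactor (G := g36c nbar) Kv β = 1 := by
    intro β
    unfold vLineFactor
    exact Fintype.prod_empty _
  have ho : ∀ ο : OLeg (g36c nbar).kind → HiggsLattice.Site P k × Fin N, oLineFactor Po Ko ο = 1 := by
    intro ο
    unfold oLineFactor
    exact Fintype.prod_empty _
  unfold graphAmp amp
  simp only [Fintype.sum_unique, hV, hs, hv, ho, mul_one]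
  -- the (1.6) rule on basis fields: Kronecker deltas
  simp only [rule16, inner_basisE]
  -- rearrange: the position sum outermost
  have h1 : ∀ α : SLeg (g36c nbar).kind → HiggsLattice.Site P 0 × Fin N,
      -(M.lamRun * ∑ x ∈ M.Ω₁, (loc (v0 nbar)).wS x * (P.mesh 0 ^ P.d *
          ((if x = (α (sl nbar 0)).1 ∧ x = (α (sl nbar 1)).1 ∧ (α (sl nbar 0)).2 = (α (sl nbar 1)).2 then (1 : ℝ) else 0) *
            (if x = (α (sl nbar 2)).1 ∧ x = (α (sl nbar 3)).1 ∧ (α (sl nbar 2)).2 = (α (sl nbar 3)).2 then (1 : ℝ) else 0)))) *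
          Φ (fun ℓ => α ℓ.1) * Ks (line0 nbar) (α (sl nbar 0)) (α (sl nbar 1)) =
        ∑ x ∈ M.Ω₁, (-(M.lamRun * ((loc (v0 nbar)).wS x * P.mesh 0 ^ P.d))) *
          ((if x = (α (sl nbar 0)).1 ∧ x = (α (sl nbar 1)).1 ∧ (α (sl nbar 0)).2 = (α (sl nbar 1)).2 then (1 : ℝ) else 0) *
            (if x = (α (sl nbar 2)).1 ∧ x = (α (sl nbar 3)).1 ∧ (α (sl nbar 2)).2 = (α (sl nbar 3)).2 then (1 : ℝ) else 0) *
            (Φ (fun ℓ => α ℓ.1) * Ks (line0 nbar) (α (sl nbar 0)) (α (sl nbar 1)))) := by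
    intro α
    rw [Finset.mul_sum, ← Finset.sum_neg_distrib, Finset.sum_mul, Finset.sum_mul]
    exact Finset.sum_congr rfl fun x _ => by ring
  rw [Finset.sum_congr rfl fun α _ => h1 α, Finset.sum_comm]
  simp only [← Finset.mul_sum]
  rw [Finset.mul_sum, ← Finset.sum_neg_distrib]
  refine Finset.sum_congr rfl fun x _ => ?_
  rw [delta_sum x (Ks (line0 nbar)) Φ]
  ring


/-- **(3.6)₃ for product external fields**: `E = −λ(L^kε) Σ_{x∈Ω₁} w(x) η^d (Σ_a G(x,x)_{aa}) (φ₂(x)·φ₃(x))` — the tadpole with the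
trace of the propagator at coinciding points. [cite: Balaban1983Higgs3, (3.6) p.435] -/
theorem graphAmp_g36c_extS (M : Model P N k) (dm2 : Fin (g36c nbar).nV → HiggsLattice.Site P 0 → ℝ)
    (loc : Fin (g36c nbar).nV → Loc P k) (Po : OutPairing (g36c nbar))
    (Ks : SLine (g36c nbar) → HiggsLattice.Site P 0 × Fin N → HiggsLattice.Site P 0 × Fin N → ℝ)
    (Kv : VLine (g36c nbar) → HiggsLattice.PBond P 0 → HiggsLattice.PBond P 0 → ℝ)
    (Ko : Po.Line oRank → HiggsLattice.Site P k × Fin N → HiggsLattice.Site P k × Fin N → ℝ)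
    (φ : ExtSLeg (g36c nbar) → HiggsLattice.ScalarField P 0 N) :
    graphAmp (g36c nbar) M dm2 loc Po Ks Kv Ko (extS (g36c nbar) φ) (fun _ => 1) (fun _ => 1) =
      -(M.lamRun * ∑ x ∈ M.Ω₁, (loc (v0 nbar)).wS x * (P.mesh 0 ^ P.d *
        ((∑ a : Fin N, Ks (line0 nbar) (x, a) (x, a)) * ⟪φ (e2 nbar) x, φ (e3 nbar) x⟫_ℝ))) := by
  rw [graphAmp_g36c]
  simp only [sum_extS_const]

end Eval

/-! ## §3 The picture (3.6)₂ (p18's `g36b`: one vertex (1.10)_{2,0}, its two A′-legs joined, both φ′-legs external) -/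

section VectorTadpole

variable {hn2 : 2 ≤ nbar}

/-- The vertex of (3.6)₂. [cite: Balaban1983Higgs3, (3.6) p.435] -/
def w0 (nbar : ℕ) (hn2 : 2 ≤ nbar) : Fin (g36b nbar hn2).nV := ⟨0, Nat.one_pos⟩

/-- The two φ′-legs of the (1.10) vertex of (3.6)₂. [cite: Balaban1983Higgs3, (3.6) p.435] -/
def sb (nbar : ℕ) (hn2 : 2 ≤ nbar) (j : Fin 2) : SLeg (g36b nbar hn2).kind := ⟨w0 nbar hn2, j⟩

/-- The two A′-legs of the (1.10) vertex of (3.6)₂. [cite: Balaban1983Higgs3, (3.6) p.435] -/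
def tb (nbar : ℕ) (hn2 : 2 ≤ nbar) (j : Fin 2) : VLeg (g36b nbar hn2).kind := ⟨w0 nbar hn2, j⟩

/-- both φ′-legs of (3.6)₂ are external. [cite: Balaban1983Higgs3, (3.6) p.435] -/
theorem sother_none : ∀ ℓ : SLeg (g36b nbar hn2).kind, (sPairing (g36b nbar hn2)).other ℓ = none := by
  show ∀ ℓ : SLeg (g36b 2 le_rfl).kind, (sPairing (g36b 2 le_rfl)).other ℓ = none
  decide

/-- every φ′-leg of (3.6)₂ is one of the two legs of its vertex. [cite: Balaban1983Higgs3, (3.6) p.435] -/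
theorem sb_cases : ∀ ℓ : SLeg (g36b nbar hn2).kind, ℓ = sb nbar hn2 0 ∨ ℓ = sb nbar hn2 1 := by
  show ∀ ℓ : SLeg (g36b 2 le_rfl).kind, ℓ = sb 2 le_rfl 0 ∨ ℓ = sb 2 le_rfl 1
  decide

/-- every A′-leg of (3.6)₂ is one of the two legs of its vertex. [cite: Balaban1983Higgs3, (3.6) p.435] -/
theorem tb_cases : ∀ ℓ : VLeg (g36b nbar hn2).kind, ℓ = tb nbar hn2 0 ∨ ℓ = tb nbar hn2 1 := by
  show ∀ ℓ : VLeg (g36b 2 le_rfl).kind, ℓ = tb 2 le_rfl 0 ∨ ℓ = tb 2 le_rfl 1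
  decide

/-- the two φ′-legs are distinct. [cite: Balaban1983Higgs3, (3.6) p.435] -/
theorem sb_injective : Function.Injective (sb nbar hn2) := by
  intro i j h
  simp only [sb, Sigma.mk.inj_iff, heq_eq_eq, true_and] at h
  exact h

/-- the two A′-legs are distinct. [cite: Balaban1983Higgs3, (3.6) p.435] -/
theorem tb_injective : Function.Injective (tb nbar hn2) := by
  intro i j h
  simp only [tb, Sigma.mk.inj_iff, heq_eq_eq, true_and] at h
  exact h

/-- in particular `tb 0 ≠ tb 1`. [cite: Balaban1983Higgs3, (3.6) p.435] -/
theorem tb0_ne_tb1 : tb nbar hn2 0 ≠ tb nbar hn2 1 := fun h => absurd (tb_injective h) (by decide)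

/-- (3.6)₂ has no φ′-line. [cite: Balaban1983Higgs3, (3.6) p.435] -/
instance instIsEmptySLine36b : IsEmpty (SLine (g36b nbar hn2)) :=
  ⟨fun l => by
    have h := l.2
    rw [(sPairing (g36b nbar hn2)).not_isLower_of_none sRank (sother_none l.1)] at h
    exact Bool.false_ne_true h⟩

/-- A′-leg 0 is joined to A′-leg 1. [cite: Balaban1983Higgs3, (3.6) p.435] -/
theorem vother_tb0 : (vPairing (g36b nbar hn2)).other (tb nbar hn2 0) = some (tb nbar hn2 1) := by
  show vpartner (g36b nbar hn2) (tb nbar hn2 0) = some (tb nbar hn2 1)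
  exact (vpartner_eq_some_iff _ _ _).2 rfl

/-- A′-leg 0 is the lower endpoint of the A′-line. [cite: Balaban1983Higgs3, (3.6) p.435] -/
theorem visLower_tb0 : (vPairing (g36b nbar hn2)).isLower vRank (tb nbar hn2 0) = true :=
  ((vPairing (g36b nbar hn2)).isLower_iff vRank _).2 ⟨tb nbar hn2 1, vother_tb0, by show Nat.pair 0 0 < Nat.pair 0 1; decide⟩

/-- … and the only one. [cite: Balaban1983Higgs3, (3.6) p.435] -/
theorem vlower_unique : ∀ ℓ : VLeg (g36b nbar hn2).kind, (vPairing (g36b nbar hn2)).isLower vRank ℓ = true → ℓ = tb nbar hn2 0 := by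
  show ∀ ℓ : VLeg (g36b 2 le_rfl).kind, (vPairing (g36b 2 le_rfl)).isLower vRank ℓ = true → ℓ = tb 2 le_rfl 0
  decide

/-- no A′-leg of (3.6)₂ is external. [cite: Balaban1983Higgs3, (3.6) p.435] -/
theorem vother_ne_none : ∀ ℓ : VLeg (g36b nbar hn2).kind, (vPairing (g36b nbar hn2)).other ℓ ≠ none := by
  show ∀ ℓ : VLeg (g36b 2 le_rfl).kind, (vPairing (g36b 2 le_rfl)).other ℓ ≠ none
  decide

/-- The A′-line of (3.6)₂. [cite: Balaban1983Higgs3, (3.6) p.435] -/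
def vline0 (nbar : ℕ) (hn2 : 2 ≤ nbar) : VLine (g36b nbar hn2) := ⟨tb nbar hn2 0, visLower_tb0⟩

/-- it is the only line. [cite: Balaban1983Higgs3, (3.6) p.435] -/
instance uniqueVLine36b : Unique (VLine (g36b nbar hn2)) where
  default := vline0 nbar hn2
  uniq := fun l => by
    rcases l with ⟨ℓ, hℓ⟩
    have := vlower_unique ℓ hℓ
    subst this
    rfl

/-- (3.6)₂ has no external A′-leg. [cite: Balaban1983Higgs3, (3.6) p.435] -/
instance instIsEmptyExtVLeg36b : IsEmpty (ExtVLeg (g36b nbar hn2)) := ⟨fun l => vother_ne_none l.1 l.2⟩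

/-- (3.6)₂ has no averaging output. [cite: Balaban1983Higgs3, (3.6) p.435] -/
instance instIsEmptyOLeg36b : IsEmpty (OLeg (g36b nbar hn2).kind) := ⟨fun ℓ => Fin.elim0 (ℓ.2 : Fin 0)⟩

/-- the mate of A′-leg 0 is A′-leg 1. [cite: Balaban1983Higgs3, (3.6) p.435] -/
theorem vmate_tb0 : (vPairing (g36b nbar hn2)).mate (tb nbar hn2 0) = tb nbar hn2 1 := (vPairing (g36b nbar hn2)).mate_eq vother_tb0

/-- The external φ′-legs of (3.6)₂ (both legs). [cite: Balaban1983Higgs3, (3.6) p.435] -/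
def es (nbar : ℕ) (hn2 : 2 ≤ nbar) (j : Fin 2) : ExtSLeg (g36b nbar hn2) := ⟨sb nbar hn2 j, sother_none _⟩

end VectorTadpole

section VectorEval

variable {P : HiggsLattice.Params} {N k : ℕ} {hn2 : 2 ≤ nbar}

/-- The basis field at a site, as a vector: `(δ_x ⊗ e_a)(x′) = [x′ = x] e_a`. [cite: Balaban1983Higgs3, p.414] -/
theorem basisE_eq {j : ℕ} (p : HiggsLattice.Site P j × Fin N) (x : HiggsLattice.Site P j) :
    basisE p x = if x = p.1 then EuclideanSpace.single p.2 (1 : ℝ) else 0 := by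
  unfold basisE
  rw [Pi.single_apply]

/-- The matrix entry `e_a·T e_{a′}` of an operator of the internal space in the orthonormal basis. [cite: Balaban1983Higgs3, (1.10) p.413] -/
def opCoeff (T : B3Eq18VertexExpansion.Op N) (a a' : Fin N) : ℝ :=
  ⟪EuclideanSpace.single a (1 : ℝ), T (EuclideanSpace.single a' (1 : ℝ))⟫_ℝ

/-- The polarized (1.10) bracket on basis fields: `[δ_p(b₋)·Tδ_{p′}(b₋)] = [b₋ = p.1][b₋ = p′.1]·(e_{p.2}·Te_{p′.2})`.
[cite: Balaban1983Higgs3, (1.10) p.413] -/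
theorem pleg110_basisE (p p' : HiggsLattice.Site P 0 × Fin N) (T : B3Eq18VertexExpansion.Op N) (b : HiggsLattice.PBond P 0) :
    pleg110 (basisE p) (basisE p') T b = (if b.src = p.1 ∧ b.src = p'.1 then (1 : ℝ) else 0) * opCoeff T p.2 p'.2 := by
  unfold pleg110 opCoeff
  rw [basisE_eq, basisE_eq]
  by_cases h : b.src = p.1
  · by_cases h' : b.src = p'.1
    · rw [if_pos h, if_pos h', if_pos (show b.src = p.1 ∧ b.src = p'.1 from ⟨h, h'⟩), one_mul]
    · rw [if_pos h, if_neg h', if_neg (show ¬(b.src = p.1 ∧ b.src = p'.1) from fun hh => h' hh.2), zero_mul, map_zero,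
        inner_zero_right]
  · rw [if_neg h, if_neg (show ¬(b.src = p.1 ∧ b.src = p'.1) from fun hh => h hh.1), zero_mul, inner_zero_left]

/-- The index assignment of (3.6)₂ with the φ′-legs 0, 1 at `(x, a)`, `(x, a′)`. [cite: Balaban1983Higgs3, (3.6) p.435] -/
def assign2 (x : HiggsLattice.Site P 0) (aa : Fin N × Fin N) : SLeg (g36b nbar hn2).kind → HiggsLattice.Site P 0 × Fin N :=
  fun ℓ => if ℓ = sb nbar hn2 0 then (x, aa.1) else (x, aa.2)

/-- `assign2` on leg 0: `(x, a)`. [cite: Balaban1983Higgs3, (3.6) p.435] -/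
theorem assign2_sb0 (x : HiggsLattice.Site P 0) (aa : Fin N × Fin N) :
    assign2 (hn2 := hn2) x aa (sb nbar hn2 0) = (x, aa.1) := by
  simp [assign2]

/-- `assign2` on leg 1: `(x, a′)`. [cite: Balaban1983Higgs3, (3.6) p.435] -/
theorem assign2_sb1 (x : HiggsLattice.Site P 0) (aa : Fin N × Fin N) :
    assign2 (hn2 := hn2) x aa (sb nbar hn2 1) = (x, aa.2) := by
  have h : sb nbar hn2 1 ≠ sb nbar hn2 0 := fun h => absurd (sb_injective h) (by decide)
  simp [assign2, h]

/-- `assign2 x` is injective. [cite: Balaban1983Higgs3, (3.6) p.435] -/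
theorem assign2_injective (x : HiggsLattice.Site P 0) : Function.Injective (assign2 (hn2 := hn2) (N := N) x) := by
  rintro ⟨a, a'⟩ ⟨c, c'⟩ h
  have h0 := congrFun h (sb nbar hn2 0)
  have h1 := congrFun h (sb nbar hn2 1)
  rw [assign2_sb0, assign2_sb0] at h0
  rw [assign2_sb1, assign2_sb1] at h1
  simp only [Prod.mk.injEq, true_and] at h0 h1
  rw [h0, h1]

/-- The external legs of (3.6)₂ at `(x, a)`, `(x, a′)`. [cite: Balaban1983Higgs3, (3.6) p.435] -/
def extAt (x : HiggsLattice.Site P 0) (aa : Fin N × Fin N) : ExtSLeg (g36b nbar hn2) → HiggsLattice.Site P 0 × Fin N :=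
  fun ℓ => assign2 x aa ℓ.1

/-- kernel: the Kronecker sum over the φ′-leg assignments of (3.6)₂ — both legs at the site `x`, free internal indices. [folklore] -/
private theorem sdelta_sum (x : HiggsLattice.Site P 0) (F : (SLeg (g36b nbar hn2).kind → HiggsLattice.Site P 0 × Fin N) → ℝ) :
    ∑ α : SLeg (g36b nbar hn2).kind → HiggsLattice.Site P 0 × Fin N,
        (if x = (α (sb nbar hn2 0)).1 ∧ x = (α (sb nbar hn2 1)).1 then (1 : ℝ) else 0) * F α =
      ∑ a : Fin N, ∑ a' : Fin N, F (assign2 x (a, a')) := by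
  classical
  set S : Finset (SLeg (g36b nbar hn2).kind → HiggsLattice.Site P 0 × Fin N) := univ.image (assign2 x) with hS
  rw [← Finset.sum_subset (Finset.subset_univ S)]
  · rw [hS, Finset.sum_image fun ab _ ab' _ h => assign2_injective x h]
    have hterm : ∀ aa : Fin N × Fin N,
        (if x = (assign2 (hn2 := hn2) x aa (sb nbar hn2 0)).1 ∧ x = (assign2 (hn2 := hn2) x aa (sb nbar hn2 1)).1
          then (1 : ℝ) else 0) * F (assign2 x aa) = F (assign2 x aa) := by
      intro aa
      rw [assign2_sb0, assign2_sb1]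
      simp
    simp only [hterm]
    rw [Fintype.sum_prod_type]
  · intro α _ hα
    by_cases h01 : x = (α (sb nbar hn2 0)).1 ∧ x = (α (sb nbar hn2 1)).1
    · exfalso
      apply hα
      rw [hS, Finset.mem_image]
      refine ⟨((α (sb nbar hn2 0)).2, (α (sb nbar hn2 1)).2), Finset.mem_univ _, ?_⟩
      funext ℓ
      rcases sb_cases ℓ with h | h <;> subst h
      · rw [assign2_sb0]; exact Prod.ext h01.1 rfl
      · rw [assign2_sb1]; exact Prod.ext h01.2 rfl
    · rw [if_neg h01, zero_mul]

/-- kernel: a vector of `W = ℝ^N` is the sum of its components times the basis vectors. [folklore] -/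
private theorem sum_smul_single (u : HiggsCovariance.E N) : ∑ a : Fin N, u a • EuclideanSpace.single a (1 : ℝ) = u := by
  ext i
  simp [Finset.sum_apply, Pi.single_apply]

/-- Contracting the matrix entries of `T` with the components of two vectors gives the bracket `u·Tv`.
[cite: Balaban1983Higgs3, (1.10) p.413] -/
theorem sum_opCoeff (T : B3Eq18VertexExpansion.Op N) (u v : HiggsCovariance.E N) :
    ∑ a : Fin N, ∑ a' : Fin N, opCoeff T a a' * (u a * v a') = ⟪u, T v⟫_ℝ := by
  conv_rhs => rw [← sum_smul_single u, ← sum_smul_single v]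
  rw [map_sum, sum_inner]
  refine Finset.sum_congr rfl fun a _ => ?_
  rw [inner_sum]
  refine Finset.sum_congr rfl fun a' _ => ?_
  rw [map_smul, real_inner_smul_left, real_inner_smul_right, opCoeff]
  ring

/-- the external φ′-legs of (3.6)₂ are exactly `es 0`, `es 1`. [cite: Balaban1983Higgs3, (3.6) p.435] -/
theorem univ_extSLeg36b : (univ : Finset (ExtSLeg (g36b nbar hn2))) = {es nbar hn2 0, es nbar hn2 1} := by
  show (univ : Finset (ExtSLeg (g36b 2 le_rfl))) = {es 2 le_rfl 0, es 2 le_rfl 1}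
  decide

/-- `es 0 ≠ es 1`. [cite: Balaban1983Higgs3, (3.6) p.435] -/
theorem es0_ne_es1 : es nbar hn2 0 ≠ es nbar hn2 1 := by
  intro h
  have h' := congrArg Subtype.val h
  exact absurd (sb_injective h') (by decide)

/-- A PRODUCT external field of (3.6)₂ at the contributing assignments. [cite: Balaban1983Higgs3, p.419] -/
theorem extS_extAt (φ : ExtSLeg (g36b nbar hn2) → HiggsLattice.ScalarField P 0 N) (x : HiggsLattice.Site P 0) (aa : Fin N × Fin N) :
    extS (g36b nbar hn2) φ (extAt x aa) = φ (es nbar hn2 0) x aa.1 * φ (es nbar hn2 1) x aa.2 := by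
  unfold extS
  rw [show (∏ ℓ : ExtSLeg (g36b nbar hn2), φ ℓ (extAt x aa ℓ).1 (extAt x aa ℓ).2) =
      ∏ ℓ ∈ ({es nbar hn2 0, es nbar hn2 1} : Finset _), φ ℓ (extAt x aa ℓ).1 (extAt x aa ℓ).2 by rw [← univ_extSLeg36b],
    Finset.prod_pair es0_ne_es1]
  show φ (es nbar hn2 0) (assign2 (hn2 := hn2) x aa (sb nbar hn2 0)).1 (assign2 (hn2 := hn2) x aa (sb nbar hn2 0)).2 *
      φ (es nbar hn2 1) (assign2 (hn2 := hn2) x aa (sb nbar hn2 1)).1 (assign2 (hn2 := hn2) x aa (sb nbar hn2 1)).2 = _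
  rw [assign2_sb0, assign2_sb1]

variable [DecidableEq (HiggsLattice.PBond P 0)]

/-- The polarized A′-legs of (3.6)₂ on basis bond fields: `Π_{j<2} g(b₋)δ_{β_j}(b) = [b = β₀][b = β₁]·g(b₋)²`.
[cite: Balaban1983Higgs3, (1.10) p.413] -/
theorem vlegs_basisV (g : HiggsLattice.Site P 0 → ℝ)
    (β : VLeg (g36b nbar hn2).kind → HiggsLattice.PBond P 0) (b : HiggsLattice.PBond P 0) :
    vlegs g (fun j => basisV (β (tb nbar hn2 j))) b =
      (if b = β (tb nbar hn2 0) ∧ b = β (tb nbar hn2 1) then (1 : ℝ) else 0) * g b.src ^ 2 := by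
  unfold vlegs basisV
  rw [Fin.prod_univ_two]
  by_cases h0 : b = β (tb nbar hn2 0) <;> by_cases h1 : b = β (tb nbar hn2 1) <;> simp [h0, h1] <;> ring

/-- kernel: the Kronecker sum over the A′-leg assignments of (3.6)₂ — both legs at the bond `b`. [folklore] -/
private theorem vdelta_sum (b : HiggsLattice.PBond P 0) (F : (VLeg (g36b nbar hn2).kind → HiggsLattice.PBond P 0) → ℝ) :
    ∑ β : VLeg (g36b nbar hn2).kind → HiggsLattice.PBond P 0,
        (if b = β (tb nbar hn2 0) ∧ b = β (tb nbar hn2 1) then (1 : ℝ) else 0) * F β = F (fun _ => b) := by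
  rw [Finset.sum_eq_single (fun _ => b)]
  · simp
  · intro β _ hβ
    have : ¬(b = β (tb nbar hn2 0) ∧ b = β (tb nbar hn2 1)) := by
      rintro ⟨h0, h1⟩
      apply hβ
      funext ℓ
      rcases tb_cases ℓ with h | h <;> subst h
      · exact h0.symm
      · exact h1.symm
    rw [if_neg this, zero_mul]
  · intro h
    exact absurd (Finset.mem_univ _) h

/-- **The evaluator EVALUATED on the picture (3.6)₂ (the A′-tadpole at the vertex (1.10)_{2,0})**: the two A′-legs joined give the
DIAGONAL of the vector line kernel at the vertex's bond, multiplied by `g_k(b₋)²`; the two external φ′-legs sit at `b₋` with free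
internal indices contracted against the entries of `q²`:
`E = (e²/2) Σ_{b∈S} w(b) η^d g(b₋)² G(b,b) Σ_{a,a′} (e_a·q²e_{a′}) Φ((b₋,a),(b₋,a′))` — *"each pair is replaced by the corresponding
propagator"* on (1.10). [cite: Balaban1983Higgs3, (3.6) p.435] -/
theorem graphAmp_g36b (M : Model P N k) (dm2 : Fin (g36b nbar hn2).nV → HiggsLattice.Site P 0 → ℝ)
    (loc : Fin (g36b nbar hn2).nV → Loc P k) (Po : OutPairing (g36b nbar hn2))
    (Ks : SLine (g36b nbar hn2) → HiggsLattice.Site P 0 × Fin N → HiggsLattice.Site P 0 × Fin N → ℝ)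
    (Kv : VLine (g36b nbar hn2) → HiggsLattice.PBond P 0 → HiggsLattice.PBond P 0 → ℝ)
    (Ko : Po.Line oRank → HiggsLattice.Site P k × Fin N → HiggsLattice.Site P k × Fin N → ℝ)
    (Φ : (ExtSLeg (g36b nbar hn2) → HiggsLattice.Site P 0 × Fin N) → ℝ) :
    graphAmp (g36b nbar hn2) M dm2 loc Po Ks Kv Ko Φ (fun _ => 1) (fun _ => 1) =
      M.C.e ^ 2 / 2 * ∑ b ∈ M.S, (loc (w0 nbar hn2)).wB b * (P.mesh 0 ^ P.d * M.g b.src ^ 2 *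
        Kv (vline0 nbar hn2) b b * ∑ a : Fin N, ∑ a' : Fin N, opCoeff (M.C.q ^ 2) a a' * Φ (extAt b.src (a, a'))) := by
  haveI : IsEmpty (Po.Line oRank) := ⟨fun l => IsEmpty.false l.1⟩
  have hV : ∀ (α : SLeg (g36b nbar hn2).kind → HiggsLattice.Site P 0 × Fin N)
      (β : VLeg (g36b nbar hn2).kind → HiggsLattice.PBond P 0) (ο : OLeg (g36b nbar hn2).kind → HiggsLattice.Site P k × Fin N),
      vertexFactor (rulesOf (g36b nbar hn2) M dm2 loc) basisE basisV basisE α β ο =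
        rule110 M.C M.g M.At 2 0 M.S (loc (w0 nbar hn2)).wB (fun j => basisE (α (sb nbar hn2 j)))
          (fun j => basisV (β (tb nbar hn2 j))) := by
    intro α β ο
    unfold vertexFactor
    exact Fin.prod_univ_one _
  have hs : ∀ α : SLeg (g36b nbar hn2).kind → HiggsLattice.Site P 0 × Fin N, sLineFactor Ks α = 1 := by
    intro α
    unfold sLineFactor
    exact Fintype.prod_empty _
  have hv : ∀ β : VLeg (g36b nbar hn2).kind → HiggsLattice.PBond P 0,
      vLineFactor Kv β = Kv (vline0 nbar hn2) (β (tb nbar hn2 0)) (β (tb nbar hn2 1)) := by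
    intro β
    unfold vLineFactor
    rw [Fintype.prod_unique]
    show Kv (vline0 nbar hn2) (β (tb nbar hn2 0)) (β ((vPairing (g36b nbar hn2)).mate (tb nbar hn2 0))) = _
    rw [vmate_tb0]
  have ho : ∀ ο : OLeg (g36b nbar hn2).kind → HiggsLattice.Site P k × Fin N, oLineFactor Po Ko ο = 1 := by
    intro ο
    unfold oLineFactor
    exact Fintype.prod_empty _
  -- the (1.10)_{2,0} rule on basis fields
  have hrule : ∀ (α : SLeg (g36b nbar hn2).kind → HiggsLattice.Site P 0 × Fin N)
      (β : VLeg (g36b nbar hn2).kind → HiggsLattice.PBond P 0),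
      rule110 M.C M.g M.At 2 0 M.S (loc (w0 nbar hn2)).wB (fun j => basisE (α (sb nbar hn2 j)))
          (fun j => basisV (β (tb nbar hn2 j))) =
        ∑ b ∈ M.S, (M.C.e ^ 2 / 2 * ((loc (w0 nbar hn2)).wB b * P.mesh 0 ^ P.d)) *
          (((if b.src = (α (sb nbar hn2 0)).1 ∧ b.src = (α (sb nbar hn2 1)).1 then (1 : ℝ) else 0) *
              opCoeff (M.C.q ^ 2) (α (sb nbar hn2 0)).2 (α (sb nbar hn2 1)).2) *
            ((if b = β (tb nbar hn2 0) ∧ b = β (tb nbar hn2 1) then (1 : ℝ) else 0) * M.g b.src ^ 2)) := by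
    intro α β
    unfold rule110
    simp only [pleg110_basisE, vlegs_basisV, pow_zero, mul_one, add_zero]
    rw [Finset.mul_sum]
    refine Finset.sum_congr rfl fun b _ => ?_
    simp only [Nat.cast_ofNat, Nat.factorial, Nat.cast_one, mul_one]
    norm_num
    ring
  unfold graphAmp amp
  simp only [Fintype.sum_unique, hV, hs, hv, ho, mul_one, one_mul, hrule]
  -- rearrange: the bond sum outermost
  have h1 : ∀ (α : SLeg (g36b nbar hn2).kind → HiggsLattice.Site P 0 × Fin N)
      (β : VLeg (g36b nbar hn2).kind → HiggsLattice.PBond P 0),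
      (∑ b ∈ M.S, (M.C.e ^ 2 / 2 * ((loc (w0 nbar hn2)).wB b * P.mesh 0 ^ P.d)) *
          (((if b.src = (α (sb nbar hn2 0)).1 ∧ b.src = (α (sb nbar hn2 1)).1 then (1 : ℝ) else 0) *
              opCoeff (M.C.q ^ 2) (α (sb nbar hn2 0)).2 (α (sb nbar hn2 1)).2) *
            ((if b = β (tb nbar hn2 0) ∧ b = β (tb nbar hn2 1) then (1 : ℝ) else 0) * M.g b.src ^ 2))) *
          Φ (fun ℓ => α ℓ.1) * Kv (vline0 nbar hn2) (β (tb nbar hn2 0)) (β (tb nbar hn2 1)) =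
        ∑ b ∈ M.S, (M.C.e ^ 2 / 2 * ((loc (w0 nbar hn2)).wB b * P.mesh 0 ^ P.d)) *
          (((if b.src = (α (sb nbar hn2 0)).1 ∧ b.src = (α (sb nbar hn2 1)).1 then (1 : ℝ) else 0) *
              (opCoeff (M.C.q ^ 2) (α (sb nbar hn2 0)).2 (α (sb nbar hn2 1)).2 * Φ (fun ℓ => α ℓ.1))) *
            ((if b = β (tb nbar hn2 0) ∧ b = β (tb nbar hn2 1) then (1 : ℝ) else 0) *
              (M.g b.src ^ 2 * Kv (vline0 nbar hn2) (β (tb nbar hn2 0)) (β (tb nbar hn2 1))))) := by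
    intro α β
    rw [Finset.sum_mul, Finset.sum_mul]
    exact Finset.sum_congr rfl fun b _ => by ring
  rw [Finset.sum_congr rfl fun α _ => Finset.sum_congr rfl fun β _ => h1 α β]
  have h2 : ∀ α : SLeg (g36b nbar hn2).kind → HiggsLattice.Site P 0 × Fin N,
      ∑ β : VLeg (g36b nbar hn2).kind → HiggsLattice.PBond P 0, ∑ b ∈ M.S,
          (M.C.e ^ 2 / 2 * ((loc (w0 nbar hn2)).wB b * P.mesh 0 ^ P.d)) *
            (((if b.src = (α (sb nbar hn2 0)).1 ∧ b.src = (α (sb nbar hn2 1)).1 then (1 : ℝ) else 0) *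
                (opCoeff (M.C.q ^ 2) (α (sb nbar hn2 0)).2 (α (sb nbar hn2 1)).2 * Φ (fun ℓ => α ℓ.1))) *
              ((if b = β (tb nbar hn2 0) ∧ b = β (tb nbar hn2 1) then (1 : ℝ) else 0) *
                (M.g b.src ^ 2 * Kv (vline0 nbar hn2) (β (tb nbar hn2 0)) (β (tb nbar hn2 1))))) =
        ∑ b ∈ M.S, (M.C.e ^ 2 / 2 * ((loc (w0 nbar hn2)).wB b * P.mesh 0 ^ P.d)) *
            (((if b.src = (α (sb nbar hn2 0)).1 ∧ b.src = (α (sb nbar hn2 1)).1 then (1 : ℝ) else 0) *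
                (opCoeff (M.C.q ^ 2) (α (sb nbar hn2 0)).2 (α (sb nbar hn2 1)).2 * Φ (fun ℓ => α ℓ.1))) *
              (M.g b.src ^ 2 * Kv (vline0 nbar hn2) b b)) := by
    intro α
    rw [Finset.sum_comm]
    refine Finset.sum_congr rfl fun b _ => ?_
    rw [← Finset.mul_sum, ← Finset.mul_sum]
    rw [vdelta_sum b fun β => M.g b.src ^ 2 * Kv (vline0 nbar hn2) (β (tb nbar hn2 0)) (β (tb nbar hn2 1))]
  rw [Finset.sum_congr rfl fun α _ => h2 α, Finset.sum_comm, Finset.mul_sum]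
  refine Finset.sum_congr rfl fun b _ => ?_
  have h3 : ∀ α : SLeg (g36b nbar hn2).kind → HiggsLattice.Site P 0 × Fin N,
      (M.C.e ^ 2 / 2 * ((loc (w0 nbar hn2)).wB b * P.mesh 0 ^ P.d)) *
          (((if b.src = (α (sb nbar hn2 0)).1 ∧ b.src = (α (sb nbar hn2 1)).1 then (1 : ℝ) else 0) *
              (opCoeff (M.C.q ^ 2) (α (sb nbar hn2 0)).2 (α (sb nbar hn2 1)).2 * Φ (fun ℓ => α ℓ.1))) *
            (M.g b.src ^ 2 * Kv (vline0 nbar hn2) b b)) =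
        (M.C.e ^ 2 / 2 * ((loc (w0 nbar hn2)).wB b * P.mesh 0 ^ P.d) * (M.g b.src ^ 2 * Kv (vline0 nbar hn2) b b)) *
          ((if b.src = (α (sb nbar hn2 0)).1 ∧ b.src = (α (sb nbar hn2 1)).1 then (1 : ℝ) else 0) *
            (opCoeff (M.C.q ^ 2) (α (sb nbar hn2 0)).2 (α (sb nbar hn2 1)).2 * Φ (fun ℓ => α ℓ.1))) := by
    intro α
    ring
  rw [Finset.sum_congr rfl fun α _ => h3 α, ← Finset.mul_sum,
    sdelta_sum b.src fun α => opCoeff (M.C.q ^ 2) (α (sb nbar hn2 0)).2 (α (sb nbar hn2 1)).2 * Φ (fun ℓ => α ℓ.1)]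
  simp only [assign2_sb0, assign2_sb1]
  unfold extAt
  ring

/-- **(3.6)₂ for product external fields**: `E = (e²/2) Σ_{b∈S} w(b) η^d g(b₋)² G(b,b) [φ₀(b₋)·q²φ₁(b₋)]` — the vertex (1.10)_{2,0}
(the typer's `vertex110 … 2 0`) with its factor `(g_kA′_b)²` REPLACED BY `g_k(b₋)²G(b,b)`: *"each pair is replaced by the
corresponding propagator"* (p. 414), computed by the general evaluator. [cite: Balaban1983Higgs3, (3.6) p.435] -/
theorem graphAmp_g36b_extS (M : Model P N k) (dm2 : Fin (g36b nbar hn2).nV → HiggsLattice.Site P 0 → ℝ)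
    (loc : Fin (g36b nbar hn2).nV → Loc P k) (Po : OutPairing (g36b nbar hn2))
    (Ks : SLine (g36b nbar hn2) → HiggsLattice.Site P 0 × Fin N → HiggsLattice.Site P 0 × Fin N → ℝ)
    (Kv : VLine (g36b nbar hn2) → HiggsLattice.PBond P 0 → HiggsLattice.PBond P 0 → ℝ)
    (Ko : Po.Line oRank → HiggsLattice.Site P k × Fin N → HiggsLattice.Site P k × Fin N → ℝ)
    (φ : ExtSLeg (g36b nbar hn2) → HiggsLattice.ScalarField P 0 N) :
    graphAmp (g36b nbar hn2) M dm2 loc Po Ks Kv Ko (extS (g36b nbar hn2) φ) (fun _ => 1) (fun _ => 1) =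
      M.C.e ^ 2 / 2 * ∑ b ∈ M.S, (loc (w0 nbar hn2)).wB b * (P.mesh 0 ^ P.d * M.g b.src ^ 2 *
        Kv (vline0 nbar hn2) b b * ⟪φ (es nbar hn2 0) b.src, (M.C.q ^ 2) (φ (es nbar hn2 1) b.src)⟫_ℝ) := by
  rw [graphAmp_g36b]
  simp only [extS_extAt, sum_opCoeff]

/-- … and on the diagonal (`φ₀ = φ₁ = φ′`) the bracket is the typer's `leg110 φ′ (q²) b`. [cite: Balaban1983Higgs3, (1.10) p.413] -/
theorem graphAmp_g36b_diag (M : Model P N k) (dm2 : Fin (g36b nbar hn2).nV → HiggsLattice.Site P 0 → ℝ)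
    (loc : Fin (g36b nbar hn2).nV → Loc P k) (Po : OutPairing (g36b nbar hn2))
    (Ks : SLine (g36b nbar hn2) → HiggsLattice.Site P 0 × Fin N → HiggsLattice.Site P 0 × Fin N → ℝ)
    (Kv : VLine (g36b nbar hn2) → HiggsLattice.PBond P 0 → HiggsLattice.PBond P 0 → ℝ)
    (Ko : Po.Line oRank → HiggsLattice.Site P k × Fin N → HiggsLattice.Site P k × Fin N → ℝ)
    (φ' : HiggsLattice.ScalarField P 0 N) :
    graphAmp (g36b nbar hn2) M dm2 loc Po Ks Kv Ko (extS (g36b nbar hn2) fun _ => φ') (fun _ => 1) (fun _ => 1) =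
      M.C.e ^ 2 / 2 * ∑ b ∈ M.S, (loc (w0 nbar hn2)).wB b * (P.mesh 0 ^ P.d * M.g b.src ^ 2 *
        Kv (vline0 nbar hn2) b b * B3Eq18VertexExpansion.leg110 φ' (M.C.q ^ 2) b) :=
  graphAmp_g36b_extS M dm2 loc Po Ks Kv Ko fun _ => φ'

end VectorEval

end

end Literature.MathematicalPhysics.QuantumFieldTheory.Balaban1983to89.B3Eq36TadpoleExpressions
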